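import Literature.AnabelianGeometry.EtaleTheta.GalSectSplittingsCohomology
import Literature.AnabelianGeometry.EtaleTheta.GKCyclotomeJunction
import HarnessLib

/-!
# [GalSect] §4 «`1 → I_x → D_x → G_K → 1`»: the quotient `D/I` of a cuspidal pair IS `Gal(K^al/K)`, topologically and
# compatibly with the Galois action on `K^al ≅ ℚ̄_p` (group side of the «κ from clause (1)» chain; proof-only)

S. Mochizuki, *Galois sections in absolute anabelian geometry* [GalSect], Nagoya Math. J. **179** (2005), §4 p. 33: «we have
an exact sequence `1 → I_x → D_x → G_K → 1`» [cite: MochizukiGalSect2005, §4 p.33]; classical Galois theory (uniqueness of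
algebraic closures, Krull topology).  abc-iut cell, layer L2, seat abc-iut-w5-d051 (gen 5); ROWS #73 R600 (B).

For an abstract cuspidal pair `P = (D, I)` in a topological group `Γ` (`GalSect.CuspPair`), a continuous augmentation
`α : Γ → G_{ℚ_p}` and a tempered curve `X` (for its base field `K ⊆ ℚ̄_p`, `G_K = K.fixingSubgroup`) such that
`I = D ∩ Ker α`, `D` is compact and `α(D) = G_K`, this PROOF-ONLY file shows

* `CuspPair.exists_quotTop_continuousMulEquiv_GK` — the quotient `↥⊤ ⧸ (I ⊆ D).subgroupOf ⊤` of `D` by `I` (the group on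
  which `CuspPair.resKerEquivH1Quotient` presents the structure group `Ker(res) ≅ H¹(D/I, I)`, abc-iut-w5-d029's
  `GalSectSplittingsCohomology`) is isomorphic AS A TOPOLOGICAL GROUP to `G_K ≤ G_{ℚ_p}` through `α` (continuous bijection
  from a compact group onto a Hausdorff one);
* **`CuspPair.exists_quotTop_continuousMulEquiv_absoluteGaloisGroup`** — composed with abc-iut-w6-d047's junction
  `exists_GK_continuousMulEquiv_absoluteGaloisGroup` (`G_K ≃ₜ* Gal(K^al/K)` with a `K`-isomorphism `ι : K^al ≃ ℚ̄_p`):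
  `∃ ι e, ∀ d y, ι (e [d] • y) = α d • ι y` with `e : (↥⊤ ⧸ …) ≃ₜ* Field.absoluteGaloisGroup K` — the datum along which the
  continuous cohomology `H¹(D/I, I)` is transported to `H¹(G_K, Ẑ(1)(K̄))` (Kummer theory, sequel files).

HONEST FRAMING: classical statements, OUR kernel check over the tree's own interfaces; [GalSect] is refereed; nothing of
[EtTh] is asserted; no side taken on [IUTchIII] Cor. 3.12; typed ≠ proved.
-/

noncomputable section

namespace Literature.AnabelianGeometry.EtaleTheta

open Literature.AnabelianGeometry.SemiGraphs _root_.Topology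
open scoped Pointwise

namespace GalSect

namespace CuspPair

variable {p : ℕ} [Fact p.Prime]
variable {Γ : Type} [Group Γ] [TopologicalSpace Γ]

/-- **`D/I ≃ₜ* G_K` through the augmentation.**  For a cuspidal pair `(D, I)` with `I = D ∩ Ker α`, `D` compact and
`α(D) = G_K`: the quotient `↥⊤ ⧸ (I.subgroupOf D).subgroupOf ⊤` is isomorphic as a topological group to `G_K ≤ G_{ℚ_p}`,
the class of `d` going to `α d` («`1 → I_x → D_x → G_K → 1`»). [cite: MochizukiGalSect2005, §4 p.33] -/
theorem exists_quotTop_continuousMulEquiv_GK (X : TemperedCurve p) (P : CuspPair Γ) (α : Γ →ₜ* GQp p)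
    (hI : P.I = P.D ⊓ α.toMonoidHom.ker) (hD : IsCompact (P.D : Set Γ))
    (hα : P.D.map α.toMonoidHom = X.GK) :
    haveI := P.ID_normal
    ∃ e : ((⊤ : Subgroup P.D) ⧸ P.ID.subgroupOf ⊤) ≃ₜ* X.GK,
      ∀ d : (⊤ : Subgroup P.D), ((e (QuotientGroup.mk d) : X.GK) : GQp p) = α ((d : P.D) : Γ) := by
  haveI := P.ID_normal
  haveI : T2Space (GQp p) := krullTopology_t2
  -- the augmentation restricted to `↥⊤ ≤ D` lands in `G_K` and is onto it
  let f₀ : (⊤ : Subgroup P.D) →* GQp p := α.toMonoidHom.comp (P.D.subtype.comp (⊤ : Subgroup P.D).subtype)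
  have hf₀ : ∀ d : (⊤ : Subgroup P.D), f₀ d = α ((d : P.D) : Γ) := fun d => rfl
  have hf₀c : Continuous f₀ := α.continuous.comp (continuous_subtype_val.comp continuous_subtype_val)
  have hmem : ∀ d : (⊤ : Subgroup P.D), f₀ d ∈ X.GK := fun d => by
    rw [← hα, hf₀]
    exact ⟨(d : P.D), (d : P.D).2, rfl⟩
  let f : (⊤ : Subgroup P.D) →* X.GK := f₀.codRestrict X.GK hmem
  have hf_apply : ∀ d, ((f d : X.GK) : GQp p) = α ((d : P.D) : Γ) := fun d => rfl
  have hf_surj : Function.Surjective f := by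
    intro g
    have hg : (g : GQp p) ∈ P.D.map α.toMonoidHom := by rw [hα]; exact g.2
    obtain ⟨d, hd, hdg⟩ := hg
    exact ⟨⟨⟨d, hd⟩, Subgroup.mem_top _⟩, Subtype.ext hdg⟩
  -- its kernel is `I` (read inside `⊤ ≤ D`)
  have hker : (P.ID.subgroupOf (⊤ : Subgroup P.D)) = f.ker := by
    ext d
    rw [Subgroup.mem_subgroupOf, MonoidHom.mem_ker, Subgroup.mem_subgroupOf, hI, Subgroup.mem_inf,
      MonoidHom.mem_ker]
    constructor
    · rintro ⟨-, h⟩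
      exact Subtype.ext h
    · intro h
      exact ⟨(d : P.D).2, congrArg Subtype.val h⟩
  let e₀ : ((⊤ : Subgroup P.D) ⧸ P.ID.subgroupOf ⊤) ≃* X.GK := QuotientGroup.liftEquiv _ hf_surj hker
  have he₀ : ∀ d : (⊤ : Subgroup P.D), e₀ (QuotientGroup.mk d) = f d := fun d =>
    QuotientGroup.liftEquiv_coe _ hf_surj hker d
  -- continuity: the lift of a continuous map through the quotient map
  have hf_cont : Continuous f := hf₀c.subtype_mk _
  have hcont : Continuous e₀ := by
    refine (QuotientGroup.isQuotientMap_mk (P.ID.subgroupOf (⊤ : Subgroup P.D))).continuous_iff.mpr ?_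
    have hfun : (e₀ : _ → X.GK) ∘ (QuotientGroup.mk : (⊤ : Subgroup P.D) → _) = f := funext fun d => he₀ d
    rw [hfun]
    exact hf_cont
  -- compact source, Hausdorff target ⇒ homeomorphism
  haveI : CompactSpace P.D := isCompact_iff_compactSpace.mp hD
  haveI : CompactSpace (⊤ : Subgroup P.D) :=
    isCompact_iff_compactSpace.mp (by
      rw [Subgroup.coe_top]
      exact isCompact_univ : IsCompact (((⊤ : Subgroup P.D) : Set P.D)))
  refine ⟨{ e₀ with
    continuous_toFun := hcont
    continuous_invFun := Continuous.continuous_symm_of_equiv_compact_to_t2 (f := e₀.toEquiv) hcont }, fun d => ?_⟩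
  change ((e₀ (QuotientGroup.mk d) : X.GK) : GQp p) = _
  rw [he₀, hf_apply]

/-- **`D/I ≃ₜ* Gal(K^al/K)`, compatibly with `K^al ≅ ℚ̄_p`.**  Under the same hypotheses there are a `K`-algebra isomorphism
`ι : K^al ≃ₐ[K] ℚ̄_p` and an isomorphism of topological groups `e : D/I ≃ₜ* Gal(K^al/K)` (Mathlib's
`Field.absoluteGaloisGroup K`, Krull topology) with `ι (e[d] • y) = α(d) • ι y` — the class of `d ∈ D` acts on `K^al` as
`α(d)` acts on `ℚ̄_p` (abc-iut-w6-d047's `exists_GK_continuousMulEquiv_absoluteGaloisGroup` BY NAME).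
[cite: MochizukiGalSect2005, §4 p.33] -/
theorem exists_quotTop_continuousMulEquiv_absoluteGaloisGroup (X : TemperedCurve p) (P : CuspPair Γ)
    (α : Γ →ₜ* GQp p) (hI : P.I = P.D ⊓ α.toMonoidHom.ker) (hD : IsCompact (P.D : Set Γ))
    (hα : P.D.map α.toMonoidHom = X.GK) :
    haveI := P.ID_normal
    ∃ (ι : AlgebraicClosure X.K ≃ₐ[X.K] PadicAlgCl p)
      (e : ((⊤ : Subgroup P.D) ⧸ P.ID.subgroupOf ⊤) ≃ₜ* Field.absoluteGaloisGroup X.K),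
      ∀ (d : (⊤ : Subgroup P.D)) (y : AlgebraicClosure X.K),
        ι (e (QuotientGroup.mk d) • y) = α ((d : P.D) : Γ) • ι y := by
  haveI := P.ID_normal
  obtain ⟨e₁, he₁⟩ := P.exists_quotTop_continuousMulEquiv_GK X α hI hD hα
  obtain ⟨ι, Φ, hΦ⟩ := exists_GK_continuousMulEquiv_absoluteGaloisGroup X
  refine ⟨ι, e₁.trans Φ, fun d y => ?_⟩
  rw [ContinuousMulEquiv.trans_apply, hΦ, he₁]

end CuspPair

end GalSect

end Literature.AnabelianGeometry.EtaleTheta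

end
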